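import Summits.CriticalPhenomena.PercolationContinuityZ3.Theorems.SahiCMTP2WeakLimits
import Summits.CriticalPhenomena.PercolationContinuityZ3.Theorems.SahiCMTP2CIS
import Summits.CriticalPhenomena.PercolationContinuityZ3.Theorems.SahiCMTP2Maps

/-!
# cMTP₂-CIS is weakly closed on the unit cube (while CIS is not)

Support file of the Sahi cell (`prim-sahi`, typer seat, generation 18; `--supports stmt-CriticalPhenomena-4575`).
One definition (the embedding `cubeEmb : Q_d × [0,1] → ℝ^d × ℝ^1`), theorems otherwise; no named facts, no sorries.

`SahiCMTP2WeakLimits` proves that Fuchs–Wang's (5.1) is closed under weak convergence on `ℝ^A × ℝ^B`; `SahiCMTP2CIS` that on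
the unit cube `IsCMTP2cis` ((5.1) for every split `([i−1],{i})`) implies CIS in the a.e.-kernel sense, which itself is
NOT weakly closed in dimension 3 (`SahiCISNonClosure.lean`).  Here the two are combined:

* `isCMTP2Set_map_cubeEmb_iff` — (5.1) for a law on `Q_d × [0,1]` ⟺ (5.1) for its image in `ℝ^d × ℝ^1` (the embedding is
  a measurable lattice embedding; lower orthants pull back to lower orthants or `∅`);
* `isCMTP2Set_of_tendsto_cube` — (5.1) is weakly closed on `Q_d × [0,1]`;
* **`isCMTP2cis_of_tendsto`** — `IsCMTP2cis d` IS CLOSED UNDER WEAK CONVERGENCE of probability measures on `Q_d`: a weakly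
  closed sufficient condition for CIS (and hence for positive association and, given `L(d,n)`, Sahi positivity),
  sitting between density-free MTP₂ (box-TP₂, also weakly closed) and CIS (not weakly closed).

No sorries, no new axioms.
-/

noncomputable section

namespace Summit.CriticalPhenomena.PercolationContinuityZ3.Theorems.SahiCMTP2

open MeasureTheory Set Filter Topology Function
open Literature.Probability.LatticeModels Literature.Probability.LatticeModels.Affiliation
open Summit.CriticalPhenomena.PercolationContinuityZ3.Theorems.SahiBoxTP2
open scoped ENNReal SetFamily unitInterval

variable {d : ℕ}

/-! ### The embedding `Q_d × [0,1] → ℝ^d × ℝ^1` -/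

/-- The embedding `(u, t) ↦ ((uᵢ)ᵢ, t)` of `Q_d × [0,1]` into `ℝ^d × ℝ^{Unit}`. [this work] -/
def cubeEmb (p : (Fin d → I) × I) : (Fin d → ℝ) × (Unit → ℝ) := (fun i => (p.1 i : ℝ), fun _ => (p.2 : ℝ))

/-- The clamping retraction `ℝ^d × ℝ^{Unit} → Q_d × [0,1]`. [this work] -/
def cubeProj (q : (Fin d → ℝ) × (Unit → ℝ)) : (Fin d → I) × I :=
  (fun i => projIcc 0 1 zero_le_one (q.1 i), projIcc 0 1 zero_le_one (q.2 ()))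

/-- `cubeEmb` is continuous. [folklore] -/
theorem continuous_cubeEmb : Continuous (cubeEmb (d := d)) :=
  (continuous_pi fun i => continuous_subtype_val.comp ((continuous_apply i).comp continuous_fst)).prodMk
    (continuous_pi fun _ => continuous_subtype_val.comp continuous_snd)

/-- `cubeEmb` is measurable. [folklore] -/
theorem measurable_cubeEmb : Measurable (cubeEmb (d := d)) := continuous_cubeEmb.measurable

/-- `cubeProj` is continuous. [folklore] -/
theorem continuous_cubeProj : Continuous (cubeProj (d := d)) := by
  refine Continuous.prodMk (continuous_pi fun i => ?_) ?_
  · exact continuous_projIcc.comp ((continuous_apply i).comp continuous_fst)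
  · exact continuous_projIcc.comp ((continuous_apply ()).comp continuous_snd)

/-- `cubeProj` is a left inverse of `cubeEmb`. [folklore] -/
theorem cubeProj_cubeEmb (p : (Fin d → I) × I) : cubeProj (cubeEmb p) = p := by
  refine Prod.ext (funext fun i => ?_) ?_
  · exact Set.projIcc_val zero_le_one (p.1 i)
  · exact Set.projIcc_val zero_le_one p.2

/-- The range of `cubeEmb`. [folklore] -/
theorem range_cubeEmb :
    range (cubeEmb (d := d)) = (Set.pi univ fun _ => Icc (0 : ℝ) 1) ×ˢ {c | c () ∈ Icc (0 : ℝ) 1} := by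
  ext q
  constructor
  · rintro ⟨p, rfl⟩
    exact ⟨fun i _ => (p.1 i).2, p.2.2⟩
  · rintro ⟨h1, h2⟩
    refine ⟨(fun i => ⟨q.1 i, h1 i (mem_univ i)⟩, ⟨q.2 (), h2⟩), Prod.ext rfl (funext fun u => ?_)⟩
    cases u; rfl

/-- `cubeEmb` is a measurable embedding. [folklore] -/
theorem measurableEmbedding_cubeEmb : MeasurableEmbedding (cubeEmb (d := d)) := by
  refine MeasurableEmbedding.of_measurable_inverse measurable_cubeEmb ?_ continuous_cubeProj.measurable
    cubeProj_cubeEmb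
  rw [range_cubeEmb]
  exact (MeasurableSet.univ_pi fun _ => measurableSet_Icc).prod (measurableSet_Icc.preimage (measurable_pi_apply ()))

/-- Pullback of a conditional-orthant event: `cubeEmb⁻¹(S × (−∞,z']) = (coe⁻¹ S) × {t | t ≤ z'()}`. [this work] -/
theorem preimage_cubeEmb_prod_Iic (S : Set (Fin d → ℝ)) (z' : Unit → ℝ) :
    cubeEmb ⁻¹' (S ×ˢ Iic z') = ((fun u : Fin d → I => fun i => (u i : ℝ)) ⁻¹' S) ×ˢ {t : I | (t : ℝ) ≤ z' ()} := by
  ext p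
  simp only [cubeEmb, mem_preimage, mem_prod, mem_Iic, mem_setOf_eq, Pi.le_def, Unique.forall_iff]

/-- `{t ∈ [0,1] | t ≤ r} = [0, π r]` for `r ≥ 0` (`π` the clamp to `[0,1]`). [folklore] -/
theorem setOf_coe_le_eq_Iic {r : ℝ} (hr : 0 ≤ r) : {t : I | (t : ℝ) ≤ r} = Iic (projIcc 0 1 zero_le_one r) := by
  ext t
  simp only [mem_setOf_eq, mem_Iic]
  rcases le_or_gt r 1 with h1 | h1
  · rw [Set.projIcc_of_mem zero_le_one ⟨hr, h1⟩]
    exact Iff.rfl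
  · rw [Set.projIcc_of_right_le zero_le_one h1.le]
    exact ⟨fun _ => le_top, fun _ => t.2.2.trans h1.le⟩

/-- `{t ∈ [0,1] | t ≤ r} = ∅` for `r < 0`. [folklore] -/
theorem setOf_coe_le_eq_empty {r : ℝ} (hr : r < 0) : {t : I | (t : ℝ) ≤ r} = ∅ :=
  Set.eq_empty_of_forall_notMem fun t ht => (lt_irrefl _ ((hr.trans_le t.2.1).trans_le' ht)).elim

/-- The coordinate embedding `Q_d → ℝ^d` is a lattice homomorphism (meets). [folklore] -/
theorem coePi_inf (u v : Fin d → I) :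
    (fun i => ((u ⊓ v) i : ℝ)) = (fun i => (u i : ℝ)) ⊓ fun i => (v i : ℝ) :=
  funext fun _ => (Subtype.mono_coe _).map_min

/-- … and joins. [folklore] -/
theorem coePi_sup (u v : Fin d → I) :
    (fun i => ((u ⊔ v) i : ℝ)) = (fun i => (u i : ℝ)) ⊔ fun i => (v i : ℝ) :=
  funext fun _ => (Subtype.mono_coe _).map_max

/-- `π r ≤ r` for `r ≥ 0` (`π` the clamp to `[0,1]`). [folklore] -/
theorem coe_projIcc_le_self {r : ℝ} (hr : 0 ≤ r) : ((projIcc (0 : ℝ) 1 zero_le_one r : I) : ℝ) ≤ r := by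
  rcases le_or_gt r 1 with h1 | h1
  · rw [Set.projIcc_of_mem zero_le_one ⟨hr, h1⟩]
  · rw [Set.projIcc_of_right_le zero_le_one h1.le]
    exact h1.le

/-! ### Transfer of (5.1) along the embedding -/

/-- **(5.1) on `Q_d × [0,1]` ⟹ (5.1) for the image law in `ℝ^d × ℝ^1`.** [this work] -/
theorem isCMTP2Set_map_cubeEmb {μ : Measure ((Fin d → I) × I)} (h : IsCMTP2Set μ) :
    IsCMTP2Set (μ.map cubeEmb) := by
  intro C' D' hC' hD' x' y'
  have hE := measurableEmbedding_cubeEmb (d := d)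
  simp only [hE.map_apply, preimage_cubeEmb_prod_Iic]
  have hcoem : Measurable fun u : Fin d → I => fun i => (u i : ℝ) :=
    measurable_pi_iff.2 fun i => measurable_subtype_coe.comp (measurable_pi_apply i)
  by_cases hx : x' () < 0
  · rw [setOf_coe_le_eq_empty hx, Set.prod_empty, measure_empty, zero_mul]; exact bot_le
  by_cases hy : y' () < 0
  · rw [setOf_coe_le_eq_empty hy, Set.prod_empty, measure_empty, mul_zero]; exact bot_le
  push Not at hx hy
  have hmin : (x' ⊓ y') () = min (x' ()) (y' ()) := rfl
  have hmax : (x' ⊔ y') () = max (x' ()) (y' ()) := rfl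
  rw [hmin, hmax, setOf_coe_le_eq_Iic hx, setOf_coe_le_eq_Iic hy]
  refine (h (hcoem hC') (hcoem hD') (projIcc 0 1 zero_le_one (x' ())) (projIcc 0 1 zero_le_one (y' ()))).trans
    (mul_le_mul' (measure_mono (Set.prod_mono ?_ fun t ht => ?_))
      (measure_mono (Set.prod_mono ?_ fun t ht => ?_)))
  · exact preimage_infs_subset_of_map_inf (φ := fun u : Fin d → I => fun i => (u i : ℝ)) coePi_inf C' D'
  · exact le_min ((Subtype.coe_le_coe.2 (le_trans ht inf_le_left)).trans (coe_projIcc_le_self hx))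
      ((Subtype.coe_le_coe.2 (le_trans ht inf_le_right)).trans (coe_projIcc_le_self hy))
  · exact preimage_sups_subset_of_map_sup (φ := fun u : Fin d → I => fun i => (u i : ℝ)) coePi_sup C' D'
  · exact (Subtype.coe_le_coe.2 (le_trans ht (sup_le (Set.monotone_projIcc zero_le_one (le_max_left _ _))
      (Set.monotone_projIcc zero_le_one (le_max_right _ _))))).trans (coe_projIcc_le_self (le_max_of_le_left hx))

/-- **(5.1) for the image law ⟹ (5.1) on `Q_d × [0,1]`** (test the image on clamp-preimages `π⁻¹C`, `π⁻¹D`). [this work] -/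
theorem isCMTP2Set_of_map_cubeEmb {μ : Measure ((Fin d → I) × I)} (h : IsCMTP2Set (μ.map cubeEmb)) :
    IsCMTP2Set μ := by
  intro C D hC hD x y
  have hE := measurableEmbedding_cubeEmb (d := d)
  set πD : (Fin d → ℝ) → (Fin d → I) := fun v i => projIcc 0 1 zero_le_one (v i) with hπD
  have hπm : Measurable πD :=
    measurable_pi_iff.2 fun i => continuous_projIcc.measurable.comp (measurable_pi_apply i)
  have hπcoe : ∀ u : Fin d → I, πD (fun i => (u i : ℝ)) = u := fun u => funext fun i => Set.projIcc_val zero_le_one (u i)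
  have key := h (hπm hC) (hπm hD) (fun _ => (x : ℝ)) (fun _ => (y : ℝ))
  simp only [hE.map_apply, preimage_cubeEmb_prod_Iic] at key
  have hpre : ∀ S : Set (Fin d → I), (fun u : Fin d → I => fun i => (u i : ℝ)) ⁻¹' (πD ⁻¹' S) = S := fun S => by
    ext u
    rw [mem_preimage, mem_preimage, hπcoe]
  have hset : ∀ z : I, {t : I | (t : ℝ) ≤ (z : ℝ)} = Iic z := fun z => by
    ext t
    simp only [mem_setOf_eq, mem_Iic, Subtype.coe_le_coe]
  have hmin : ((fun _ : Unit => (x : ℝ)) ⊓ fun _ => (y : ℝ)) () = ((x ⊓ y : I) : ℝ) :=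
    ((Subtype.mono_coe _).map_min).symm
  have hmax : ((fun _ : Unit => (x : ℝ)) ⊔ fun _ => (y : ℝ)) () = ((x ⊔ y : I) : ℝ) :=
    ((Subtype.mono_coe _).map_max).symm
  rw [hpre, hpre, hmin, hmax, hset, hset, hset, hset] at key
  refine key.trans (mul_le_mul' (measure_mono (Set.prod_mono ?_ Subset.rfl))
    (measure_mono (Set.prod_mono ?_ Subset.rfl)))
  · intro u hu
    obtain ⟨v, hv, w, hw, hvw⟩ := Set.mem_infs.1 hu
    refine Set.mem_infs.2 ⟨πD v, hv, πD w, hw, funext fun i => ?_⟩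
    have hi : v i ⊓ w i = (u i : ℝ) := congr_fun hvw i
    show projIcc (0 : ℝ) 1 zero_le_one (v i) ⊓ projIcc 0 1 zero_le_one (w i) = u i
    rcases le_total (v i) (w i) with hle | hle
    · rw [inf_eq_left.2 hle] at hi
      exact (inf_eq_left.2 (Set.monotone_projIcc zero_le_one hle)).trans (hi.symm ▸ Set.projIcc_val zero_le_one (u i))
    · rw [inf_eq_right.2 hle] at hi
      exact (inf_eq_right.2 (Set.monotone_projIcc zero_le_one hle)).trans (hi.symm ▸ Set.projIcc_val zero_le_one (u i))
  · intro u hu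
    obtain ⟨v, hv, w, hw, hvw⟩ := Set.mem_sups.1 hu
    refine Set.mem_sups.2 ⟨πD v, hv, πD w, hw, funext fun i => ?_⟩
    have hi : v i ⊔ w i = (u i : ℝ) := congr_fun hvw i
    show projIcc (0 : ℝ) 1 zero_le_one (v i) ⊔ projIcc 0 1 zero_le_one (w i) = u i
    have hv' : v i ≤ (u i : ℝ) := hi ▸ le_sup_left
    have hw' : w i ≤ (u i : ℝ) := hi ▸ le_sup_right
    refine le_antisymm (sup_le ?_ ?_) ?_
    · simpa only [Set.projIcc_val] using Set.monotone_projIcc zero_le_one hv'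
    · simpa only [Set.projIcc_val] using Set.monotone_projIcc zero_le_one hw'
    · rcases le_total (v i) (w i) with hle | hle
      · have hw : w i = (u i : ℝ) := by rw [← hi]; exact (sup_eq_right.2 hle).symm
        calc u i = projIcc 0 1 zero_le_one (u i : ℝ) := (Set.projIcc_val zero_le_one _).symm
          _ = projIcc 0 1 zero_le_one (w i) := by rw [hw]
          _ ≤ _ := le_sup_right
      · have hv : v i = (u i : ℝ) := by rw [← hi]; exact (sup_eq_left.2 hle).symm
        calc u i = projIcc 0 1 zero_le_one (u i : ℝ) := (Set.projIcc_val zero_le_one _).symm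
          _ = projIcc 0 1 zero_le_one (v i) := by rw [hv]
          _ ≤ _ := le_sup_left

/-- **(5.1) on `Q_d × [0,1]` ⟺ (5.1) for the image in `ℝ^d × ℝ^1`.** [this work] -/
theorem isCMTP2Set_map_cubeEmb_iff (μ : Measure ((Fin d → I) × I)) : IsCMTP2Set (μ.map cubeEmb) ↔ IsCMTP2Set μ :=
  ⟨isCMTP2Set_of_map_cubeEmb, isCMTP2Set_map_cubeEmb⟩

/-! ### Weak closure on the cube -/

/-- **(5.1) is closed under weak convergence on `Q_d × [0,1]`** (transport to `ℝ^d × ℝ^1` and back). [this work] -/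
theorem isCMTP2Set_of_tendsto_cube {T : Type*} {L : Filter T} [NeBot L]
    {μs : T → ProbabilityMeasure ((Fin d → I) × I)} {μ : ProbabilityMeasure ((Fin d → I) × I)}
    (hconv : Tendsto μs L (𝓝 μ)) (h : ∀ᶠ i in L, IsCMTP2Set (μs i : Measure ((Fin d → I) × I))) :
    IsCMTP2Set (μ : Measure ((Fin d → I) × I)) := by
  have hlim := ProbabilityMeasure.tendsto_map_of_tendsto_of_continuous μs μ hconv continuous_cubeEmb
  have key := isCMTP2Set_of_tendsto (ι := Fin d) (κ := Unit) hlim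
    (h.mono fun i hi => by simpa only [ProbabilityMeasure.toMeasure_map] using isCMTP2Set_map_cubeEmb hi)
  rw [ProbabilityMeasure.toMeasure_map] at key
  exact isCMTP2Set_of_map_cubeEmb key

/-- `initLast` is continuous. [folklore] -/
theorem continuous_initLast : Continuous (initLast (d := d)) :=
  (continuous_pi fun _ => continuous_apply _).prodMk (continuous_apply _)

/-- **cMTP₂-CIS (`IsCMTP2cis`) is closed under weak convergence** of probability measures on `Q_d`, every `d` — a weakly
closed sufficient condition for CIS (which is not weakly closed, `SahiCISNonClosure.lean`). [this work] -/
theorem isCMTP2cis_of_tendsto :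
    ∀ (d : ℕ) {T : Type*} {L : Filter T} [NeBot L] {μs : T → ProbabilityMeasure (Fin d → I)}
      {μ : ProbabilityMeasure (Fin d → I)}, Tendsto μs L (𝓝 μ) →
      (∀ᶠ i in L, IsCMTP2cis d (μs i : Measure (Fin d → I))) → IsCMTP2cis d (μ : Measure (Fin d → I)) := by
  intro d
  induction d with
  | zero => intro T L _ μs μ _ _; trivial
  | succ d ih =>
    intro T L _ μs μ hconv h
    have hcI : Continuous (initLast (d := d)) := continuous_initLast
    have hlim := ProbabilityMeasure.tendsto_map_of_tendsto_of_continuous μs μ hconv hcI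
    have hlim' := ProbabilityMeasure.tendsto_map_of_tendsto_of_continuous _ _ hlim continuous_fst
    refine ⟨?_, ?_⟩
    · have key := ih hlim' (h.mono fun i hi => ?_)
      · simpa only [ProbabilityMeasure.toMeasure_map, Measure.fst] using key
      · simpa only [ProbabilityMeasure.toMeasure_map, Measure.fst] using hi.1
    · have key := isCMTP2Set_of_tendsto_cube hlim (h.mono fun i hi => ?_)
      · simpa only [ProbabilityMeasure.toMeasure_map] using key
      · simpa only [ProbabilityMeasure.toMeasure_map] using hi.2

end Summit.CriticalPhenomena.PercolationContinuityZ3.Theorems.SahiCMTP2
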